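import Literature.NumberTheory.DiophantineGeometry.PastenValuationProductsProofs
import Literature.NumberTheory.DiophantineGeometry.ValuationProductEllipticManyPrimesProofs
import HarnessLib

/-!
# Pasten, Theorem 16.5 (second part), `IsSemistable` vocabulary: what the printed arguments establish

Sibling proof file of `PastenValuationProducts.lean` for the named fact
`Literature.NumberTheory.DiophantineGeometry.pasten_valuationProduct_semistable_manyPrimes`
(H. Pasten, *Shimura curves and the abc conjecture*, J. Number Theory **254** (2024) 214–335 =
arXiv:1705.09251v4, §16.3, "Theorem 16.5" of the arXiv text, second display): "If moreover `ε > 0`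
and `E` has at least `3 + 11/ε` places of bad reduction, then `∏_{p ∣ N_E} v_p(Δ_E) <
K_ε · N_E^{8/3+ε}`" (for semi-stable `E/ℚ`), vendored verbatim with `3 + 11/ε ≤ #{p ∣ N_E}` and
semi-stability as `W.IsSemistable ℤ`.

## Statement versus printed proof (the boundary `#{p ∣ N_E} = 3 + 11/ε`)

The printed proof (arXiv p. 50) reduces the second display to Theorem 16.4 (i) (semi-stable `E`,
admissible `N = DM`, `M` not prime, `N ≫_ε 1`: `∏_{p ∣ D} v_p(Δ) < N^{8/3+ε} M`): for `n = ω(N)`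
even take `D = N`; for `n` odd take `M =` three cyclically consecutive primes and `(n-3)`-rd roots,
which yields the exponent `(8/3+ε')·n/(n-3) + 3/(n-3)`, and this is `< 8/3 + ε` iff
`n > 3 + 11/ε` — the proof says so itself ("for all integers `n > 11/ε + 3`"). So the printed
ARGUMENT proves the display for curves with MORE THAN `3 + 11/ε` bad places; the two readings
differ exactly when `11/ε = m ∈ ℕ`, for curves with exactly `m + 3` bad places. Of these boundary
cases the paper's other results still cover: `m` odd (`n` even, `D = N`); `m = 2` (`ε = 11/2`:
Theorem 1.12, since `11/2 < 8/3 + 11/2`); `m = 4, 6, 8` (Theorem 16.1 with `D = N/p_i` and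
`(n-1)`-st roots as in the proof of Corollary 16.2: `(11/3)·n/(n-1) < 8/3 + 11/(n-3)` iff
`n ≤ 11`). For `m` even `≥ 10` (`ε = 11/10, 11/12, …`) curves with exactly `m + 3` bad places are
NOT covered by any estimate of the paper: by the mediant inequality no weighted combination of the
bounds of Theorems 16.1 / 16.4 (i) over admissible factorisations beats the better pure strategy,
and the error terms `O(log N / log log N)` of the method give `N^{8/3 + ε + o(1)}`, not
`K_ε N^{8/3+ε}`. This analysis, with the arithmetic of both root tricks, is formalised for the
duplicate vendoring `pastenShimura2024_thm_16_5_manyPrimes` (semi-stable as `Squarefree N_E`) in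
`ValuationProductEllipticManyPrimesProofs.lean`; the present file transports it to the
`IsSemistable` vocabulary of `pasten_valuationProduct_semistable_manyPrimes` along the bridges of
`PastenValuationProductsProofs.lean` (`WeierstrassCurve.isSemistable_iff_squarefree_conductorNorm`,
`pasten_valuationProduct_semistable_iff_pastenShimura2024_thm_1_12`, `valuationProduct_def`) and
adds the logical decomposition of the vendored statement into its strict part and its boundary
family, isolating exactly the instances the literature leaves open.

No new named facts (D-0026): Theorems 16.1 and 16.4 (i) — the heart of the paper (Shimura-curve
parametrisations, refined Ribet–Takahashi, Arakelov bounds for integral quaternionic forms,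
modularity), none of it in Mathlib — enter only as the explicit hypotheses `h161`, `h164`
(semi-stable case; "all but finitely many `E`" / "`N ≫_ε 1`" rendered as `N_E ≥ N₀(ε)`), and
Theorem 1.12 as the tree's named fact `pasten_valuationProduct_semistable` (hypothesis `h112`).

## Contents

* `thm_16_1_hyp_squarefree_of_isSemistable`, `thm_16_4_hyp_squarefree_of_isSemistable` — the two
  inline hypotheses, `IsSemistable` phrasing ⟹ `Squarefree` phrasing.
* `pasten_valuationProduct_semistable_manyPrimes_strict_of_thm_16_4` — the CORRECTED (strict,
  "more than `3 + 11/ε`") statement from `h112`, `h164`.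
* `pasten_valuationProduct_semistable_manyPrimes_at_of_strict` — off the boundary (`11/ε ∉ ℕ`) the
  vendored "at least" form at `ε` follows from the strict form.
* `valuationProduct_lt_of_semistable_of_gt` — for `ε > 17/6` the display follows from Theorem 1.12
  with no hypothesis on the number of bad places (`11/2 + (ε - 17/6) = 8/3 + ε`).
* `pasten_valuationProduct_semistable_manyPrimes_at_of_thm_16_1_of_thm_16_4` — from `h112`, `h161`,
  `h164` the vendored statement holds at every `ε > 0` with `11/ε ∉ {10, 12, 14, …}`.
* `pasten_valuationProduct_semistable_manyPrimes_iff_strict_and_boundary` — the vendored statement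
  is equivalent to (strict form) ∧ (boundary family over all `m ≥ 1`).
* `pasten_valuationProduct_semistable_manyPrimes_iff_openBoundary_of_thm_16_1_of_thm_16_4` — modulo
  `h112`, `h161`, `h164`, the vendored statement is equivalent to the OPEN boundary family
  (`m` even `≥ 10`): exactly what remains to be proved.
* `pasten_manyPrimes_boundary_certificate` — the exponent bookkeeping behind "not covered": for
  `n ≥ 12` bad primes of equal size the uniform point `y_p = (8/3 + 11/(n-3))/n` satisfies every
  linear constraint that Theorem 16.4 (i), Theorem 16.1 and the first display impose on the
  normalised valuations, and sums to exactly `8/3 + 11/(n-3)` (`= 8/3 + ε` at the boundary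
  `n = 3 + 11/ε`); with the failure of the Theorem-16.1 clause at `n = 11` (sharpness).

## References

* [PastenShimura2024] H. Pasten, *Shimura curves and the abc conjecture*, J. Number Theory 254
  (2024) 214–335, doi:10.1016/j.jnt.2023.07.002 = arXiv:1705.09251v4: §16.1 Theorem 16.1 and
  Corollary 16.2 with proof (p. 49), §16.2 Theorem 16.4, §16.3 Theorem 16.5 with proof (p. 50),
  p. 12 (admissible factorisations, Shafarevich reduction).
-/

noncomputable section

open Finset

namespace Literature.NumberTheory.DiophantineGeometry

/-! ### The inline hypotheses in the two vocabularies -/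

/-- Theorem 16.1 (semi-stable case, `S = ∅`, threshold form) phrased with `W.IsSemistable ℤ`
implies the same statement phrased with `Squarefree (W.conductorNorm ℤ)` (the phrasing of
`ValuationProductEllipticManyPrimesProofs.lean`), by
`WeierstrassCurve.isSemistable_iff_squarefree_conductorNorm`.
[cite: PastenShimura2024, Theorem 16.1 (arXiv numbering)] -/
theorem thm_16_1_hyp_squarefree_of_isSemistable
    (h161 : ∀ ε : ℝ, 0 < ε → ∃ N₀ : ℕ, ∀ (W : WeierstrassCurve ℚ) [W.IsElliptic],
      W.IsSemistable ℤ → N₀ ≤ W.conductorNorm ℤ →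
        ∀ D : ℕ, 1 < D → D ∣ W.conductorNorm ℤ → Even D.primeFactors.card →
          ((∏ p ∈ D.primeFactors, (W.minimalDiscriminantNorm ℤ).factorization p : ℕ) : ℝ)
            < (W.conductorNorm ℤ : ℝ) ^ ((11 : ℝ) / 3 + ε)) :
    ∀ ε : ℝ, 0 < ε → ∃ N₀ : ℕ, ∀ (W : WeierstrassCurve ℚ) [W.IsElliptic],
      Squarefree (W.conductorNorm ℤ) → N₀ ≤ W.conductorNorm ℤ →
        ∀ D : ℕ, 1 < D → D ∣ W.conductorNorm ℤ → Even D.primeFactors.card →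
          ((∏ p ∈ D.primeFactors, (W.minimalDiscriminantNorm ℤ).factorization p : ℕ) : ℝ)
            < (W.conductorNorm ℤ : ℝ) ^ (11 / 3 + ε : ℝ) := by
  intro ε hε
  obtain ⟨N₀, hN₀⟩ := h161 ε hε
  exact ⟨N₀, fun W _ hsq hle => hN₀ W ((W.isSemistable_iff_squarefree_conductorNorm).mpr hsq) hle⟩

/-- Theorem 16.4 (i) (semi-stable case, threshold form) phrased with `W.IsSemistable ℤ` implies the
same statement phrased with `Squarefree (W.conductorNorm ℤ)`.
[cite: PastenShimura2024, Theorem 16.4 (i) (arXiv numbering)] -/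
theorem thm_16_4_hyp_squarefree_of_isSemistable
    (h164 : ∀ ε : ℝ, 0 < ε → ∃ N₀ : ℕ, ∀ (W : WeierstrassCurve ℚ) [W.IsElliptic],
      W.IsSemistable ℤ → N₀ ≤ W.conductorNorm ℤ →
        ∀ D : ℕ, 1 < D → D ∣ W.conductorNorm ℤ → Even D.primeFactors.card →
          ¬ (W.conductorNorm ℤ / D).Prime →
            ((∏ p ∈ D.primeFactors, (W.minimalDiscriminantNorm ℤ).factorization p : ℕ) : ℝ)
              < (W.conductorNorm ℤ : ℝ) ^ ((8 : ℝ) / 3 + ε) * ((W.conductorNorm ℤ / D : ℕ) : ℝ)) :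
    ∀ ε : ℝ, 0 < ε → ∃ N₀ : ℕ, ∀ (W : WeierstrassCurve ℚ) [W.IsElliptic],
      Squarefree (W.conductorNorm ℤ) → N₀ ≤ W.conductorNorm ℤ →
        ∀ D : ℕ, 1 < D → D ∣ W.conductorNorm ℤ → Even D.primeFactors.card →
          ¬ (W.conductorNorm ℤ / D).Prime →
            ((∏ p ∈ D.primeFactors, (W.minimalDiscriminantNorm ℤ).factorization p : ℕ) : ℝ)
              < (W.conductorNorm ℤ : ℝ) ^ (8 / 3 + ε : ℝ) * ((W.conductorNorm ℤ / D : ℕ) : ℝ) := by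
  intro ε hε
  obtain ⟨N₀, hN₀⟩ := h164 ε hε
  exact ⟨N₀, fun W _ hsq hle => hN₀ W ((W.isSemistable_iff_squarefree_conductorNorm).mpr hsq) hle⟩

/-! ### The corrected (strict) statement, and the vendored statement off the boundary -/

/-- **Pasten, Theorem 16.5, second part, as established by the printed proof — `IsSemistable`
vocabulary.** From Theorem 1.12 (the named fact `pasten_valuationProduct_semistable`, used only
for the finitely many small conductors; the paper uses Shafarevich finiteness, p. 12 — declared
deviation) and Theorem 16.4 (i) in the semi-stable case (explicit hypothesis `h164`, NOT a vendored
fact): for every `ε > 0` there is `K > 0` such that every semi-stable `E/ℚ` with MORE THAN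
`3 + 11/ε` places of bad reduction satisfies `∏_{p ∣ N_E} v_p(Δ_E) < K · N_E^{8/3+ε}`. This is the
CORRECTED form of the vendored `pasten_valuationProduct_semistable_manyPrimes` ("at least"), see
the module docstring; it is `pastenShimura2024_thm_16_5_manyPrimes_strict_of_thm_16_4` transported
along `WeierstrassCurve.isSemistable_iff_squarefree_conductorNorm` and
`pasten_valuationProduct_semistable_iff_pastenShimura2024_thm_1_12`.
[cite: PastenShimura2024, Theorem 16.5 (arXiv numbering), second part, with its proof p. 50] -/
theorem pasten_valuationProduct_semistable_manyPrimes_strict_of_thm_16_4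
    (h112 : pasten_valuationProduct_semistable)
    (h164 : ∀ ε : ℝ, 0 < ε → ∃ N₀ : ℕ, ∀ (W : WeierstrassCurve ℚ) [W.IsElliptic],
      W.IsSemistable ℤ → N₀ ≤ W.conductorNorm ℤ →
        ∀ D : ℕ, 1 < D → D ∣ W.conductorNorm ℤ → Even D.primeFactors.card →
          ¬ (W.conductorNorm ℤ / D).Prime →
            ((∏ p ∈ D.primeFactors, (W.minimalDiscriminantNorm ℤ).factorization p : ℕ) : ℝ)
              < (W.conductorNorm ℤ : ℝ) ^ ((8 : ℝ) / 3 + ε) * ((W.conductorNorm ℤ / D : ℕ) : ℝ)) :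
    ∀ ε : ℝ, 0 < ε → ∃ K : ℝ, 0 < K ∧ ∀ (W : WeierstrassCurve ℚ) [W.IsElliptic],
      W.IsSemistable ℤ → (3 : ℝ) + 11 / ε < ((W.conductorNorm ℤ).primeFactors.card : ℝ) →
        (valuationProduct W : ℝ) < K * (W.conductorNorm ℤ : ℝ) ^ ((8 : ℝ) / 3 + ε) := by
  intro ε hε
  obtain ⟨K, hK, h⟩ := pastenShimura2024_thm_16_5_manyPrimes_strict_of_thm_16_4
    (pasten_valuationProduct_semistable_iff_pastenShimura2024_thm_1_12.mp h112)
    (thm_16_4_hyp_squarefree_of_isSemistable h164) ε hε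
  refine ⟨K, hK, fun W _ hss hn => ?_⟩
  simpa only [valuationProduct_def] using
    h W ((W.isSemistable_iff_squarefree_conductorNorm).mp hss) hn

/-- **Off the boundary the vendored form follows from the strict form.** If `11/ε ∉ ℕ`, "at least
`3 + 11/ε` places" and "more than `3 + 11/ε` places" coincide, so at such an `ε` the conclusion of
`pasten_valuationProduct_semistable_manyPrimes` follows from the strict statement (e.g. from
`pasten_valuationProduct_semistable_manyPrimes_strict_of_thm_16_4`). The exceptional values are
`ε = 11/m`, `m ∈ ℕ`. [cite: PastenShimura2024, Theorem 16.5 (arXiv numbering), second part] -/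
theorem pasten_valuationProduct_semistable_manyPrimes_at_of_strict
    (hstrict : ∀ ε : ℝ, 0 < ε → ∃ K : ℝ, 0 < K ∧ ∀ (W : WeierstrassCurve ℚ) [W.IsElliptic],
      W.IsSemistable ℤ → (3 : ℝ) + 11 / ε < ((W.conductorNorm ℤ).primeFactors.card : ℝ) →
        (valuationProduct W : ℝ) < K * (W.conductorNorm ℤ : ℝ) ^ ((8 : ℝ) / 3 + ε))
    {ε : ℝ} (hε : 0 < ε) (hnat : ∀ m : ℕ, (11 : ℝ) / ε ≠ m) :
    ∃ K : ℝ, 0 < K ∧ ∀ (W : WeierstrassCurve ℚ) [W.IsElliptic],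
      W.IsSemistable ℤ → (3 : ℝ) + 11 / ε ≤ ((W.conductorNorm ℤ).primeFactors.card : ℝ) →
        (valuationProduct W : ℝ) < K * (W.conductorNorm ℤ : ℝ) ^ ((8 : ℝ) / 3 + ε) := by
  obtain ⟨K, hK, h⟩ := hstrict ε hε
  refine ⟨K, hK, fun W _ hss hn => h W hss (lt_of_le_of_ne hn fun heq => ?_)⟩
  have h3 : 3 ≤ (W.conductorNorm ℤ).primeFactors.card := by
    exact_mod_cast (show (3 : ℝ) ≤ (W.conductorNorm ℤ).primeFactors.card by
      linarith [show (0 : ℝ) < 11 / ε by positivity])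
  refine hnat ((W.conductorNorm ℤ).primeFactors.card - 3) ?_
  push_cast [h3]
  linarith

/-- **Large `ε` needs no hypothesis on the number of bad places.** For `ε > 17/6` the second
display of Theorem 16.5 follows from the first (Theorem 1.12, the named fact
`pasten_valuationProduct_semistable`) for ALL semi-stable `E/ℚ`, because
`11/2 + (ε - 17/6) = 8/3 + ε`. In particular the boundary value `ε = 11/2` (`m = 2`, curves with
`5` bad primes) is covered by Theorem 1.12. [cite: PastenShimura2024, Theorem 1.12 and Theorem 16.5] -/
theorem valuationProduct_lt_of_semistable_of_gt (h112 : pasten_valuationProduct_semistable)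
    {ε : ℝ} (hε : (17 : ℝ) / 6 < ε) :
    ∃ K : ℝ, 0 < K ∧ ∀ (W : WeierstrassCurve ℚ) [W.IsElliptic], W.IsSemistable ℤ →
      (valuationProduct W : ℝ) < K * (W.conductorNorm ℤ : ℝ) ^ ((8 : ℝ) / 3 + ε) := by
  obtain ⟨K, hK, h⟩ := h112 (ε - 17 / 6) (by linarith)
  refine ⟨K, hK, fun W _ hss => ?_⟩
  have hexp : (11 : ℝ) / 2 + (ε - 17 / 6) = (8 : ℝ) / 3 + ε := by ring
  have h' := h W hss
  rwa [hexp] at h'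

/-! ### The vendored statement at every `ε` the paper's results reach -/

/-- **What the literature establishes of `pasten_valuationProduct_semistable_manyPrimes`.** From
Theorem 1.12 (named fact, hypothesis `h112`), Theorem 16.1 (semi-stable case `S = ∅`, hypothesis
`h161`: for `N_E ≥ N₀(ε)` and every divisor `1 < D ∣ N_E` with an even number of prime factors,
`∏_{p ∣ D} v_p(Δ_E) < N_E^{11/3+ε}`) and Theorem 16.4 (i) (semi-stable case, hypothesis `h164`:
same with `N_E/D` not prime and bound `N_E^{8/3+ε} · (N_E/D)`) of arXiv:1705.09251, the vendored
second display of Theorem 16.5 — "at least `3 + 11/ε` places of bad reduction ⟹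
`∏_{p ∣ N_E} v_p(Δ_E) < K_ε · N_E^{8/3+ε}`" — holds at every `ε > 0` such that `11/ε` is not an
even integer `≥ 10` (hypothesis `hgap`). This is
`pastenShimura2024_thm_16_5_manyPrimes_of_thm_1_12_of_thm_16_1_of_thm_16_4` (strict theorem off the
boundary; at the boundary `n = m + 3`: Theorem 16.4 (i) with `D = N` for `n` even, Theorem 16.1
over the `n` factorisations `D = N/p_i` for `n ∈ {5, 7, 9, 11}`) transported to the `IsSemistable`
vocabulary. The excluded values `ε = 11/m`, `m` even `≥ 10`, are exactly the instances not
established in the literature (module docstring).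
[cite: PastenShimura2024, Theorems 1.12, 16.1, 16.4 (i), 16.5 and the proofs of Cor. 16.2 / Thm 16.5 (arXiv numbering)] -/
theorem pasten_valuationProduct_semistable_manyPrimes_at_of_thm_16_1_of_thm_16_4
    (h112 : pasten_valuationProduct_semistable)
    (h161 : ∀ ε : ℝ, 0 < ε → ∃ N₀ : ℕ, ∀ (W : WeierstrassCurve ℚ) [W.IsElliptic],
      W.IsSemistable ℤ → N₀ ≤ W.conductorNorm ℤ →
        ∀ D : ℕ, 1 < D → D ∣ W.conductorNorm ℤ → Even D.primeFactors.card →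
          ((∏ p ∈ D.primeFactors, (W.minimalDiscriminantNorm ℤ).factorization p : ℕ) : ℝ)
            < (W.conductorNorm ℤ : ℝ) ^ ((11 : ℝ) / 3 + ε))
    (h164 : ∀ ε : ℝ, 0 < ε → ∃ N₀ : ℕ, ∀ (W : WeierstrassCurve ℚ) [W.IsElliptic],
      W.IsSemistable ℤ → N₀ ≤ W.conductorNorm ℤ →
        ∀ D : ℕ, 1 < D → D ∣ W.conductorNorm ℤ → Even D.primeFactors.card →
          ¬ (W.conductorNorm ℤ / D).Prime →
            ((∏ p ∈ D.primeFactors, (W.minimalDiscriminantNorm ℤ).factorization p : ℕ) : ℝ)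
              < (W.conductorNorm ℤ : ℝ) ^ ((8 : ℝ) / 3 + ε) * ((W.conductorNorm ℤ / D : ℕ) : ℝ))
    {ε : ℝ} (hε : 0 < ε) (hgap : ∀ m : ℕ, (11 : ℝ) / ε = m → Even m → m ≤ 8) :
    ∃ K : ℝ, 0 < K ∧ ∀ (W : WeierstrassCurve ℚ) [W.IsElliptic],
      W.IsSemistable ℤ → (3 : ℝ) + 11 / ε ≤ ((W.conductorNorm ℤ).primeFactors.card : ℝ) →
        (valuationProduct W : ℝ) < K * (W.conductorNorm ℤ : ℝ) ^ ((8 : ℝ) / 3 + ε) := by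
  obtain ⟨K, hK, h⟩ := pastenShimura2024_thm_16_5_manyPrimes_of_thm_1_12_of_thm_16_1_of_thm_16_4
    (pasten_valuationProduct_semistable_iff_pastenShimura2024_thm_1_12.mp h112)
    (thm_16_1_hyp_squarefree_of_isSemistable h161) (thm_16_4_hyp_squarefree_of_isSemistable h164)
    hε hgap
  refine ⟨K, hK, fun W _ hss hn => ?_⟩
  simpa only [valuationProduct_def] using
    h W ((W.isSemistable_iff_squarefree_conductorNorm).mp hss) hn

/-! ### The vendored statement = strict part + boundary part -/

/-- **Logical decomposition of the vendored statement.** `pasten_valuationProduct_semistable_manyPrimes`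
("at least `3 + 11/ε` places") is equivalent to the conjunction of (a) its strict form ("more than
`3 + 11/ε` places" — what the printed proof establishes, cf.
`pasten_valuationProduct_semistable_manyPrimes_strict_of_thm_16_4`) and (b) the boundary family:
for every integer `m ≥ 1`, semi-stable curves with exactly `m + 3` bad places satisfy
`∏_{p ∣ N_E} v_p(Δ_E) < K_m · N_E^{8/3 + 11/m}` (the vendored statement at `ε = 11/m`). By the
module docstring, (b) is covered by the paper's arguments for `m` odd and `m ∈ {2, 4, 6, 8}`, and is
open for `m` even `≥ 10`. [cite: PastenShimura2024, Theorem 16.5 (arXiv numbering), second part] -/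
theorem pasten_valuationProduct_semistable_manyPrimes_iff_strict_and_boundary :
    pasten_valuationProduct_semistable_manyPrimes ↔
      ((∀ ε : ℝ, 0 < ε → ∃ K : ℝ, 0 < K ∧ ∀ (W : WeierstrassCurve ℚ) [W.IsElliptic],
          W.IsSemistable ℤ → (3 : ℝ) + 11 / ε < ((W.conductorNorm ℤ).primeFactors.card : ℝ) →
            (valuationProduct W : ℝ) < K * (W.conductorNorm ℤ : ℝ) ^ ((8 : ℝ) / 3 + ε)) ∧
        ∀ m : ℕ, 0 < m → ∃ K : ℝ, 0 < K ∧ ∀ (W : WeierstrassCurve ℚ) [W.IsElliptic],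
          W.IsSemistable ℤ → (W.conductorNorm ℤ).primeFactors.card = m + 3 →
            (valuationProduct W : ℝ) <
              K * (W.conductorNorm ℤ : ℝ) ^ ((8 : ℝ) / 3 + 11 / (m : ℝ))) := by
  classical
  constructor
  · intro h
    refine ⟨fun ε hε => ?_, fun m hm => ?_⟩
    · obtain ⟨K, hK, hW⟩ := h ε hε
      exact ⟨K, hK, fun W _ hss hn => hW W hss hn.le⟩
    · have hmpos : (0 : ℝ) < m := by exact_mod_cast hm
      obtain ⟨K, hK, hW⟩ := h (11 / (m : ℝ)) (by positivity)
      refine ⟨K, hK, fun W _ hss hc => hW W hss ?_⟩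
      have h11 : (11 : ℝ) / (11 / (m : ℝ)) = m := by field_simp
      rw [h11, hc]
      push_cast
      linarith
  · rintro ⟨hs, hb⟩ ε hε
    by_cases hnat : ∃ m : ℕ, (11 : ℝ) / ε = m
    swap
    · push Not at hnat
      exact pasten_valuationProduct_semistable_manyPrimes_at_of_strict hs hε hnat
    obtain ⟨m, hm⟩ := hnat
    have h11 : (0 : ℝ) < 11 / ε := by positivity
    have hm0 : m ≠ 0 := by
      rintro rfl
      rw [Nat.cast_zero] at hm
      exact h11.ne' hm
    have hmpos : (0 : ℝ) < m := by exact_mod_cast Nat.pos_of_ne_zero hm0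
    have hεm : ε = 11 / m := by
      rw [eq_div_iff hmpos.ne', ← hm]
      field_simp
    obtain ⟨Ks, hKs, hs⟩ := hs ε hε
    obtain ⟨Kb, hKb, hb⟩ := hb m (Nat.pos_of_ne_zero hm0)
    refine ⟨max Ks Kb, lt_max_of_lt_left hKs, fun W _ hss hn => ?_⟩
    have hrpow : 0 ≤ (W.conductorNorm ℤ : ℝ) ^ ((8 : ℝ) / 3 + ε) :=
      Real.rpow_nonneg (Nat.cast_nonneg _) _
    rcases hn.lt_or_eq with hlt | heq
    · exact (hs W hss hlt).trans_le (mul_le_mul_of_nonneg_right (le_max_left _ _) hrpow)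
    · have hc : (W.conductorNorm ℤ).primeFactors.card = m + 3 := by
        rw [hm] at heq
        exact_mod_cast
          (by linarith : (((W.conductorNorm ℤ).primeFactors.card : ℕ) : ℝ) = (m : ℝ) + 3)
      have h' := hb W hss hc
      rw [← hεm] at h'
      exact h'.trans_le (mul_le_mul_of_nonneg_right (le_max_right _ _) hrpow)

/-- **Modulo the paper's theorems, the vendored statement is equivalent to its open boundary
family.** Assuming Theorem 1.12 (named fact `h112`), Theorem 16.1 (`h161`) and Theorem 16.4 (i)
(`h164`) of arXiv:1705.09251 in the semi-stable case, `pasten_valuationProduct_semistable_manyPrimes`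
holds iff for every EVEN integer `m ≥ 10` there is `K_m` with `∏_{p ∣ N_E} v_p(Δ_E) <
K_m · N_E^{8/3 + 11/m}` for all semi-stable `E/ℚ` with exactly `m + 3` places of bad reduction —
the family of instances not established in the literature (module docstring). (⟸: at `ε = 11/m`,
`m` even `≥ 10`, combine the strict theorem with the hypothesis; elsewhere
`pasten_valuationProduct_semistable_manyPrimes_at_of_thm_16_1_of_thm_16_4`.)
[cite: PastenShimura2024, Theorems 1.12, 16.1, 16.4 (i), 16.5 (arXiv numbering)] -/
theorem pasten_valuationProduct_semistable_manyPrimes_iff_openBoundary_of_thm_16_1_of_thm_16_4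
    (h112 : pasten_valuationProduct_semistable)
    (h161 : ∀ ε : ℝ, 0 < ε → ∃ N₀ : ℕ, ∀ (W : WeierstrassCurve ℚ) [W.IsElliptic],
      W.IsSemistable ℤ → N₀ ≤ W.conductorNorm ℤ →
        ∀ D : ℕ, 1 < D → D ∣ W.conductorNorm ℤ → Even D.primeFactors.card →
          ((∏ p ∈ D.primeFactors, (W.minimalDiscriminantNorm ℤ).factorization p : ℕ) : ℝ)
            < (W.conductorNorm ℤ : ℝ) ^ ((11 : ℝ) / 3 + ε))
    (h164 : ∀ ε : ℝ, 0 < ε → ∃ N₀ : ℕ, ∀ (W : WeierstrassCurve ℚ) [W.IsElliptic],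
      W.IsSemistable ℤ → N₀ ≤ W.conductorNorm ℤ →
        ∀ D : ℕ, 1 < D → D ∣ W.conductorNorm ℤ → Even D.primeFactors.card →
          ¬ (W.conductorNorm ℤ / D).Prime →
            ((∏ p ∈ D.primeFactors, (W.minimalDiscriminantNorm ℤ).factorization p : ℕ) : ℝ)
              < (W.conductorNorm ℤ : ℝ) ^ ((8 : ℝ) / 3 + ε) * ((W.conductorNorm ℤ / D : ℕ) : ℝ)) :
    pasten_valuationProduct_semistable_manyPrimes ↔
      ∀ m : ℕ, Even m → 10 ≤ m → ∃ K : ℝ, 0 < K ∧ ∀ (W : WeierstrassCurve ℚ) [W.IsElliptic],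
        W.IsSemistable ℤ → (W.conductorNorm ℤ).primeFactors.card = m + 3 →
          (valuationProduct W : ℝ) < K * (W.conductorNorm ℤ : ℝ) ^ ((8 : ℝ) / 3 + 11 / (m : ℝ)) := by
  classical
  constructor
  · intro h m _ hm
    exact (pasten_valuationProduct_semistable_manyPrimes_iff_strict_and_boundary.mp h).2 m (by omega)
  · intro hopen ε hε
    by_cases hbad : ∃ m : ℕ, (11 : ℝ) / ε = m ∧ Even m ∧ 10 ≤ m
    swap
    · push Not at hbad
      refine pasten_valuationProduct_semistable_manyPrimes_at_of_thm_16_1_of_thm_16_4 h112 h161 h164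
        hε fun m hm hme => ?_
      have hlt := hbad m hm hme
      obtain ⟨k, hk⟩ := hme
      omega
    obtain ⟨m, hm, hme, hm10⟩ := hbad
    have hmpos : (0 : ℝ) < m := by exact_mod_cast (show 0 < m by omega)
    have hεm : ε = 11 / m := by
      rw [eq_div_iff hmpos.ne', ← hm]
      field_simp
    obtain ⟨Ks, hKs, hs⟩ :=
      pasten_valuationProduct_semistable_manyPrimes_strict_of_thm_16_4 h112 h164 ε hε
    obtain ⟨Kb, hKb, hb⟩ := hopen m hme hm10
    refine ⟨max Ks Kb, lt_max_of_lt_left hKs, fun W _ hss hn => ?_⟩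
    have hrpow : 0 ≤ (W.conductorNorm ℤ : ℝ) ^ ((8 : ℝ) / 3 + ε) :=
      Real.rpow_nonneg (Nat.cast_nonneg _) _
    rcases hn.lt_or_eq with hlt | heq
    · exact (hs W hss hlt).trans_le (mul_le_mul_of_nonneg_right (le_max_left _ _) hrpow)
    · have hc : (W.conductorNorm ℤ).primeFactors.card = m + 3 := by
        rw [hm] at heq
        exact_mod_cast
          (by linarith : (((W.conductorNorm ℤ).primeFactors.card : ℕ) : ℝ) = (m : ℝ) + 3)
      have h' := hb W hss hc
      rw [← hεm] at h'
      exact h'.trans_le (mul_le_mul_of_nonneg_right (le_max_right _ _) hrpow)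

/-!
## The boundary obstruction as a linear-programming certificate

Why no bookkeeping with the paper's bounds reaches the boundary `n = 3 + 11/ε`, `n` odd `≥ 13`
(module docstring).  For a semi-stable `E/ℚ` with bad primes `p_1, …, p_n` put
`ℓ_i = log p_i / log N` (so `Σ ℓ_i = 1`) and `y_i = log v_{p_i}(Δ_E) / log N`.  Letting `N → ∞`
and `ε' → 0`, the estimates available in [PastenShimura2024] are the linear constraints
* Theorem 16.4 (i) (`N = DM` admissible, `M` not prime, `#M = k ≠ 1`):
  `Σ_{i ∈ D} y_i ≤ 8/3 + Σ_{i ∈ M} ℓ_i`;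
* Theorem 16.1 (`N = DM` admissible, any `k ≥ 1`): `Σ_{i ∈ D} y_i ≤ 11/3`;
* Theorem 16.5, first display (Theorem 1.12): `Σ_i y_i ≤ 11/2`;
and the second display at the boundary asks for `Σ_i y_i < 8/3 + 11/(n-3)`.  At the uniform point
`ℓ_i = 1/n`, `y_i = (8/3 + 11/(n-3))/n` every constraint holds as soon as `n ≥ 12` (whatever the
parities of `#D`, `#M`, so a fortiori for the admissible ones), while `Σ_i y_i = 8/3 + 11/(n-3)`
exactly: no non-negative combination of the constraints certifies the strict inequality, i.e. the
boundary instances `m = n - 3` even `≥ 10` of the vendored statement are not consequences of the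
paper's stated bounds (for `m ∈ {4, 6, 8}`, i.e. `n ∈ {7, 9, 11}`, the Theorem-16.1 clause fails at
`k = 1` — see the `example` — and that route does prove the boundary case, as recorded above).
This is a statement about the METHOD (exponent bookkeeping), not about curves: it does not refute
the boundary statement, which presumably holds.
-/

/-- **LP certificate for the boundary of Pasten's Theorem 16.5, second display.**  For `n ≥ 12`
the uniform normalised point `y = (8/3 + 11/(n-3))/n` (all `n` bad primes of equal size `1/n`)
satisfies (a) every Theorem-16.4 (i)-shaped constraint `(n-k)·y ≤ 8/3 + k/n` (`#M = k ≥ 3`),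
(b) every Theorem-16.1-shaped constraint `(n-k)·y ≤ 11/3` (`#M = k ≥ 1`), (c) the first display
`n·y ≤ 11/2`, and (d) `n·y = 8/3 + 11/(n-3)` — the boundary exponent itself; in (a) the slack is
exactly `11(k-3)/(3(n-3))`, vanishing at the paper's choice `k = 3`.  Hence for `n` odd `≥ 13`
(`ε = 11/(n-3)`, `11/ε` even `≥ 10`) the boundary case of the printed statement is out of reach of
the printed bounds (see the discussion above). [cite: PastenShimura2024, Theorems 16.1, 16.4 (i),
16.5 with the proofs of Corollary 16.2 and Theorem 16.5, arXiv pp. 49–50] -/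
theorem pasten_manyPrimes_boundary_certificate {n : ℕ} (hn : 12 ≤ n) :
    (∀ k : ℕ, 3 ≤ k → k ≤ n →
        ((n : ℝ) - k) * ((8 / 3 + 11 / ((n : ℝ) - 3)) / n) ≤ 8 / 3 + (k : ℝ) / n) ∧
    (∀ k : ℕ, 1 ≤ k → k ≤ n →
        ((n : ℝ) - k) * ((8 / 3 + 11 / ((n : ℝ) - 3)) / n) ≤ 11 / 3) ∧
    (n : ℝ) * ((8 / 3 + 11 / ((n : ℝ) - 3)) / n) ≤ 11 / 2 ∧
    (n : ℝ) * ((8 / 3 + 11 / ((n : ℝ) - 3)) / n) = 8 / 3 + 11 / ((n : ℝ) - 3) := by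
  have hn' : (12 : ℝ) ≤ n := by exact_mod_cast hn
  have hn0 : (n : ℝ) ≠ 0 := by positivity
  have h3 : (0 : ℝ) < (n : ℝ) - 3 := by linarith
  have hd : (n : ℝ) * ((8 / 3 + 11 / ((n : ℝ) - 3)) / n) = 8 / 3 + 11 / ((n : ℝ) - 3) := by
    field_simp
  refine ⟨fun k hk _ => ?_, fun k hk hkn => ?_, ?_, hd⟩
  · -- (a): slack `11(k-3)/(3(n-3)) ≥ 0`
    have hk' : (3 : ℝ) ≤ k := by exact_mod_cast hk
    have key : (8 : ℝ) / 3 + (k : ℝ) / n - ((n : ℝ) - k) * ((8 / 3 + 11 / ((n : ℝ) - 3)) / n)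
        = 11 * ((k : ℝ) - 3) / (3 * ((n : ℝ) - 3)) := by
      field_simp
      ring
    have : 0 ≤ 11 * ((k : ℝ) - 3) / (3 * ((n : ℝ) - 3)) :=
      div_nonneg (by linarith) (by linarith)
    linarith
  · -- (b): slack `(3n² - 42n + 8kn + 9k)/(3n(n-3)) ≥ (3n² - 34n + 9)/(3n(n-3)) ≥ 0` for `n ≥ 12`
    have hk' : (1 : ℝ) ≤ k := by exact_mod_cast hk
    have hkn' : (k : ℝ) ≤ n := by exact_mod_cast hkn
    have key : (11 : ℝ) / 3 - ((n : ℝ) - k) * ((8 / 3 + 11 / ((n : ℝ) - 3)) / n)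
        = (3 * (n : ℝ) ^ 2 - 42 * n + 8 * k * n + 9 * k) / (3 * n * ((n : ℝ) - 3)) := by
      field_simp
      ring
    have hnum : 0 ≤ 3 * (n : ℝ) ^ 2 - 42 * n + 8 * k * n + 9 * k := by nlinarith
    have : 0 ≤ (3 * (n : ℝ) ^ 2 - 42 * n + 8 * k * n + 9 * k) / (3 * n * ((n : ℝ) - 3)) :=
      div_nonneg hnum (by positivity)
    linarith
  · -- (c): `8/3 + 11/(n-3) ≤ 8/3 + 11/9 < 11/2`
    rw [hd]
    have : 11 / ((n : ℝ) - 3) ≤ 11 / 9 := div_le_div_of_nonneg_left (by norm_num) (by norm_num) (by linarith)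
    linarith

/-- Sharpness of `12 ≤ n` in clause (b): at `n = 11`, `k = 1` the Theorem-16.1-shaped constraint
FAILS at the uniform point — consistent with the fact that for `n ∈ {7, 9, 11}` Theorem 16.1 with
`(n-1)`-st roots does prove the boundary case (module docstring). [cite: PastenShimura2024,
proof of Corollary 16.2] -/
example : ¬ (((11 : ℝ) - 1) * ((8 / 3 + 11 / ((11 : ℝ) - 3)) / 11) ≤ 11 / 3) := by norm_num

end Literature.NumberTheory.DiophantineGeometry

end
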